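import Literature.NumberTheory.PAdicHodge.BdRPeriodRingData
import Literature.NumberTheory.PAdicHodge.BdRPlusLog
import Literature.NumberTheory.PAdicHodge.HodgeTateCyclotomic
import Literature.NumberTheory.GaloisRepresentations.PeriodRingDataCharacter
import Literature.NumberTheory.PAdicHodge.CyclotomicDeRhamClause
import HarnessLib

/-!
# The cyclotomic character is `B_dR`-admissible (de Rham) of Hodge–Tate weight `-1`

For the genuine de Rham datum `bdRPeriodRingData hp` (`B_dR(F) = Frac B_dR⁺(F)` with
`Fil^i = ξ^i B_dR⁺`, `BdRPeriodRingData`) and the canonical `ℚ_p`-structure on the `p`-adic field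
`F`, the continuous character `ℚ_p(1)` (`cyclotomicRepQp F p`) is **`B_dR`-admissible with
`D_dR(ℚ_p(1)) = F · t⁻¹` and Hodge–Tate weights `{-1}`** — Fontaine 1994, Exp. III §1.5 with
Exp. II §1.5.5 (`σ t = χ(σ) t`, `Fil^i B_dR = t^i B_dR⁺`); Buzzard–Gee's sign convention.

The period is `s = t⁻¹` with `t = log [ε]` (`BdRPlusLog.tBdR`, `galBdRPlus_tBdR`):
`χ(σ)·σ(t⁻¹) = t⁻¹` (`smul_tFrac_inv`) and `t⁻¹ ∈ Fil^i ↔ i ≤ -1` (`tFrac_inv_mem_fil_iff`: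
`t = ξ·unit`, and `t⁻¹ ∉ B_dR⁺` as `t ∈ ker θ`); the conclusions are the generic rank-one period
lemmas of `PeriodRingDataCharacter`. This is clause (F2) `CyclotomicWeightNegOne` of
`IsFontaineDatum` at the level of the period-ring datum (the `ℚ_p`-linear representation `ℚ_p(1)`).

## References
* [FontaineAsterisque223III] J.-M. Fontaine, Astérisque 223 (1994), Exp. II §1.5.5, Exp. III §1.5.
* [FontaineOuyang2022] J.-M. Fontaine, Y. Ouyang, *Theory of p-adic Galois representations*, §5.2.
* [BuzzardGee2014] K. Buzzard, T. Gee, *The conjectural connections …* (2014), §2.2.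
-/

noncomputable section

open ValuativeRel Field Ideal WittVector UniformSpace
open Literature.AlgebraicGeometry.Resolution

namespace Literature.NumberTheory.PAdicHodge

open Literature.NumberTheory.GaloisRepresentations
open Literature.NumberTheory.GaloisRepresentations.IsNonarchimedeanLocalField

variable {F : Type} [Field F] [ValuativeRel F] [TopologicalSpace F] [IsNonarchimedeanLocalField F]
  [CharZero F] {p : ℕ} [Fact p.Prime] [Fact (¬ IsUnit (p : integerC F))]
  [IsAdicComplete (Ideal.span {(p : integerC F)}) (integerC F)]

/-! ### `t` and `t⁻¹` in `B_dR(F)` -/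

/-- **`t ∈ B_dR(F)`**, the image of `t = log [ε] ∈ B_dR⁺(F)`. [cite: FontaineAsterisque223III, Exp. II §1.5.5] -/
def tFrac : FracBdR F p := algebraMap (BDeRhamPlus (integerC F) p) (FracBdR F p) tBdR

/-- Unfolding of `tFrac`. [folklore] -/
theorem tFrac_def : (tFrac : FracBdR F p) = algebraMap (BDeRhamPlus (integerC F) p) (FracBdR F p) tBdR := rfl

/-- The scalar `χ(σ) ∈ B_dR(F)` (through `ℚ_p → B_dR⁺ → B_dR`). [folklore] -/
def chiFrac (σ : absoluteGaloisGroup F) : FracBdR F p :=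
  algebraMap (BDeRhamPlus (integerC F) p) (FracBdR F p)
    (qpToBdR (((GaloisRep.cyclotomicCharacter F p σ : ℤ_[p]ˣ) : ℤ_[p]) : ℚ_[p]))

/-- **`σ(t) = χ(σ)·t` in `B_dR(F)`.** [cite: FontaineAsterisque223III, Exp. II §1.5.5] -/
theorem smul_tFrac (σ : absoluteGaloisGroup F) : σ • (tFrac : FracBdR F p) = chiFrac σ * tFrac := by
  rw [tFrac_def, smul_algebraMap_fracBdR, galBdRPlus_tBdR, map_mul]; rfl

variable (hF : Function.Surjective (fontaineTheta (integerC F) p))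

include hF in
/-- `χ(σ) ≠ 0` in `B_dR(F)`. [folklore] -/
theorem chiFrac_ne_zero (σ : absoluteGaloisGroup F) : (chiFrac σ : FracBdR F p) ≠ 0 := by
  rw [chiFrac, map_ne_zero_iff _ algebraMap_fracBdR_injective]
  haveI := isLocalRing_bDeRhamPlus (F := F) (p := p) hF
  exact (IsUnit.map qpToBdR (Ne.isUnit (PadicInt.coe_ne_zero.2 (GaloisRep.cyclotomicCharacter F p σ).ne_zero))).ne_zero

include hF in
/-- **`t ≠ 0` in `B_dR(F)`.** [cite: FontaineAsterisque223III, Exp. II §1.5.5] -/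
theorem tFrac_ne_zero : (tFrac : FracBdR F p) ≠ 0 := by
  rw [tFrac_def, map_ne_zero_iff _ algebraMap_fracBdR_injective]
  exact tBdR_ne_zero hF

variable [IsDomain (BDeRhamPlus (integerC F) p)]

include hF in
/-- **`t⁻¹` is a period of `ℚ_p(1)`: `χ(σ)·σ(t⁻¹) = t⁻¹`.** [cite: FontaineAsterisque223III, Exp. III §1.5]
[cite: FontaineOuyang2022, §5.2] -/
theorem chiFrac_mul_smul_tFrac_inv (σ : absoluteGaloisGroup F) :
    chiFrac σ * σ • (tFrac : FracBdR F p)⁻¹ = tFrac⁻¹ := by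
  rw [smul_inv'', smul_tFrac, mul_inv, ← mul_assoc, mul_inv_cancel₀ (chiFrac_ne_zero hF σ), one_mul]

variable (hp : valuation F p < 1)

include hF in
/-- **`t⁻¹ ∈ Fil^i B_dR ↔ i ≤ -1`** (`t = ξ·unit`; `t⁻¹ ∉ Fil⁰ = B_dR⁺` since `θ(t) = 0`).
[cite: FontaineAsterisque223III, Exp. II §1.5.5] -/
theorem tFrac_inv_mem_fil_iff (i : ℤ) :
    (letI := fracAlgebra (p := p) hp hF; (tFrac : FracBdR F p)⁻¹ ∈ fil hp hF i) ↔ i ≤ -1 := by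
  letI := fracAlgebra (p := p) hp hF
  obtain ⟨w, hw, htw⟩ := exists_tBdR_eq_xiBdR_mul (F := F) (p := p) hF
  constructor
  · intro h
    by_contra hi
    have h0 : (tFrac : FracBdR F p)⁻¹ ∈ fil hp hF 0 := fil_antitone hp hF (by omega) h
    rw [mem_fil_iff] at h0
    obtain ⟨b, hb⟩ := h0
    rw [zpow_zero, one_mul, tFrac_def] at hb
    have h1 : algebraMap (BDeRhamPlus (integerC F) p) (FracBdR F p) (tBdR * b) = 1 := by
      rw [map_mul, ← hb, mul_inv_cancel₀]
      rw [← tFrac_def]; exact tFrac_ne_zero hF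
    have h2 : IsUnit (tBdR : BDeRhamPlus (integerC F) p) :=
      IsUnit.of_mul_eq_one b (algebraMap_fracBdR_injective (h1.trans (map_one _).symm))
    exact ((isUnit_iff_thetaBdR_ne_zero hF _).1 h2) (thetaBdR_eq_zero_of_mem_span tBdR_mem_span_xiBdR)
  · intro hi
    refine fil_antitone hp hF hi ?_
    rw [mem_fil_iff]
    refine ⟨((hw.unit⁻¹ : (BDeRhamPlus (integerC F) p)ˣ) : BDeRhamPlus (integerC F) p), ?_⟩
    rw [algebraMap_units_inv, IsUnit.unit_spec, zpow_neg_one, ← mul_inv, ← map_mul, ← htw, tFrac_def]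

/-! ### The cyclotomic character is de Rham of weight `-1` -/

section Datum

variable [Algebra ℚ_[p] F]

omit [IsDomain (BDeRhamPlus (integerC F) p)] in
/-- The `F`-algebra map of the datum is `F ↪ B_dR⁺ ⊆ B_dR`. [folklore] -/
theorem algebraMap_bdRPeriodRingData (x : F) :
    algebraMap F (bdRPeriodRingData (F := F) (p := p) hp).B x =
      algebraMap (BDeRhamPlus (integerC F) p) (FracBdR F p) (embBdRHom hp hF x) := rfl

omit hF [IsDomain (BDeRhamPlus (integerC F) p)] in
/-- For the canonical `ℚ_p`-structure, `ℚ_p → F → B_dR⁺` is `qpToBdR`. [folklore] -/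
theorem embBdRHom_algebraMap_padic (hF : Function.Surjective (fontaineTheta (integerC F) p))
    (halg : ∀ c : ℚ_[p], algebraMap ℚ_[p] F c = LocalField.padicRingHom F p hp c) (c : ℚ_[p]) :
    embBdRHom hp hF (algebraMap ℚ_[p] F c) = qpToBdR c := by
  rw [halg]
  exact embBdRHom_algebraMap hp hF ((PadicBase.toPadic hp).symm c)

omit hF [IsDomain (BDeRhamPlus (integerC F) p)] in
/-- For the canonical `ℚ_p`-structure, the scalar `χ(σ) ∈ B_dR` of the datum is `chiFrac σ`. [folklore] -/
theorem algebraMap_chi_bdRPeriodRingData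
    (halg : ∀ c : ℚ_[p], algebraMap ℚ_[p] F c = LocalField.padicRingHom F p hp c) (σ : absoluteGaloisGroup F) :
    algebraMap ℚ_[p] (bdRPeriodRingData (F := F) (p := p) hp).B (PeriodRingData.chi (cyclotomicRepQp F p) σ) =
      (chiFrac σ : FracBdR F p) := by
  rw [PeriodRingData.algebraMap_eq, PeriodRingData.chi, cyclotomicRepQp_apply, mul_one,
    algebraMap_bdRPeriodRingData (surjective_fontaineTheta_integerC hp) hp,
    embBdRHom_algebraMap_padic hp (surjective_fontaineTheta_integerC hp) halg]
  rfl

omit hF in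
/-- **`t⁻¹` is a nonzero period of `ℚ_p(1)` in the datum `bdRPeriodRingData hp`.**
[cite: FontaineAsterisque223III, Exp. III §1.5] -/
theorem bdRPeriodRingData_period
    (halg : ∀ c : ℚ_[p], algebraMap ℚ_[p] F c = LocalField.padicRingHom F p hp c) (σ : absoluteGaloisGroup F) :
    algebraMap ℚ_[p] (bdRPeriodRingData (F := F) (p := p) hp).B (PeriodRingData.chi (cyclotomicRepQp F p) σ) *
        σ • (show (bdRPeriodRingData (F := F) (p := p) hp).B from ((tFrac : FracBdR F p)⁻¹ : FracBdR F p)) =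
      (show (bdRPeriodRingData (F := F) (p := p) hp).B from ((tFrac : FracBdR F p)⁻¹ : FracBdR F p)) := by
  rw [algebraMap_chi_bdRPeriodRingData hp halg]
  exact chiFrac_mul_smul_tFrac_inv (surjective_fontaineTheta_integerC hp) σ

omit hF in
/-- **`ℚ_p(1)` is `B_dR`-admissible (de Rham)** for the canonical `ℚ_p`-structure on `F`:
`dim_F (B_dR ⊗ ℚ_p(1))^{Γ_F} = 1`. [cite: FontaineAsterisque223III, Exp. III §1.5]
[cite: FontaineOuyang2022, §5.2] -/
theorem isAdmissible_bdR_cyclotomicRepQp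
    (halg : ∀ c : ℚ_[p], algebraMap ℚ_[p] F c = LocalField.padicRingHom F p hp c) :
    (bdRPeriodRingData (F := F) (p := p) hp).IsAdmissible (cyclotomicRepQp F p) := by
  refine PeriodRingData.isAdmissible_of_period
    (s := show (bdRPeriodRingData (F := F) (p := p) hp).B from ((tFrac : FracBdR F p)⁻¹ : FracBdR F p)) ?_
    (bdRPeriodRingData_period hp halg)
  exact inv_ne_zero (tFrac_ne_zero (surjective_fontaineTheta_integerC hp))

omit hF in
/-- **The Hodge–Tate weight of the cyclotomic character is `-1`** for `B_dR(F)` (convention of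
`PeriodRingData.hodgeTateWeights`). [cite: FontaineAsterisque223III, Exp. III §1.5]
[cite: BuzzardGee2014, §2.2] -/
theorem hodgeTateWeights_bdR_cyclotomicRepQp
    (halg : ∀ c : ℚ_[p], algebraMap ℚ_[p] F c = LocalField.padicRingHom F p hp c) :
    (bdRPeriodRingData (F := F) (p := p) hp).hodgeTateWeights (cyclotomicRepQp F p) = {-1} := by
  refine PeriodRingData.hodgeTateWeights_eq
    (s := show (bdRPeriodRingData (F := F) (p := p) hp).B from ((tFrac : FracBdR F p)⁻¹ : FracBdR F p)) ?_
    (bdRPeriodRingData_period hp halg) (w := -1) fun i => ?_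
  · exact inv_ne_zero (tFrac_ne_zero (surjective_fontaineTheta_integerC hp))
  · exact tFrac_inv_mem_fil_iff (surjective_fontaineTheta_integerC hp) hp i

end Datum

/-! ### The canonical `ℚ_p`-structure -/

omit [Fact (¬ IsUnit (p : integerC F))] [IsAdicComplete (Ideal.span {(p : integerC F)}) (integerC F)] hF
  [IsDomain (BDeRhamPlus (integerC F) p)] in
/-- **`ℚ_p(1)` is de Rham** for `B_dR(F)` with the canonical `ℚ_p`-algebra structure
`LocalField.padicAlgebra F p hp`. [cite: FontaineAsterisque223III, Exp. III §1.5] -/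
theorem isAdmissible_bdR_cyclotomicRepQp_padicAlgebra :
    letI := LocalField.padicAlgebra F p hp
    haveI : Fact (¬ IsUnit (p : integerC F)) := ⟨not_isUnit_natCast_integerC hp⟩
    haveI := isAdicComplete_integerC_natCast (F := F) hp
    (bdRPeriodRingData (F := F) (p := p) hp).IsAdmissible (cyclotomicRepQp F p) := by
  letI := LocalField.padicAlgebra F p hp
  haveI : Fact (¬ IsUnit (p : integerC F)) := ⟨not_isUnit_natCast_integerC hp⟩
  haveI := isAdicComplete_integerC_natCast (F := F) hp
  haveI := isDomain_bDeRhamPlus (F := F) (p := p) (surjective_fontaineTheta_integerC hp)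
  exact isAdmissible_bdR_cyclotomicRepQp hp fun c => rfl

omit [Fact (¬ IsUnit (p : integerC F))] [IsAdicComplete (Ideal.span {(p : integerC F)}) (integerC F)] hF
  [IsDomain (BDeRhamPlus (integerC F) p)] in
/-- **The cyclotomic character has Hodge–Tate weight `-1`** for `B_dR(F)` with the canonical
`ℚ_p`-algebra structure. [cite: FontaineAsterisque223III, Exp. III §1.5] [cite: BuzzardGee2014, §2.2] -/
theorem hodgeTateWeights_bdR_cyclotomicRepQp_padicAlgebra :
    letI := LocalField.padicAlgebra F p hp
    haveI : Fact (¬ IsUnit (p : integerC F)) := ⟨not_isUnit_natCast_integerC hp⟩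
    haveI := isAdicComplete_integerC_natCast (F := F) hp
    (bdRPeriodRingData (F := F) (p := p) hp).hodgeTateWeights (cyclotomicRepQp F p) = {-1} := by
  letI := LocalField.padicAlgebra F p hp
  haveI : Fact (¬ IsUnit (p : integerC F)) := ⟨not_isUnit_natCast_integerC hp⟩
  haveI := isAdicComplete_integerC_natCast (F := F) hp
  haveI := isDomain_bDeRhamPlus (F := F) (p := p) (surjective_fontaineTheta_integerC hp)
  exact hodgeTateWeights_bdR_cyclotomicRepQp hp fun c => rfl

omit [Fact (¬ IsUnit (p : integerC F))] [IsAdicComplete (Ideal.span {(p : integerC F)}) (integerC F)] hF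
  [IsDomain (BDeRhamPlus (integerC F) p)] in
/-- **Clause (F2) of `IsFontaineDatum` for the genuine datum `B_dR(F)`**: the cyclotomic character
`Γ_F → GL_1(ℚ̄_p)` is `B_dR`-de Rham with all Hodge–Tate weights in `[-1, -1]`
(`FramedRep.IsDeRhamWithWeightsIn`, the shape of `PstWeilDeligneData.CyclotomicWeightNegOne`).
[cite: FontaineAsterisque223III, Exp. III §1.5] [cite: BuzzardGee2014, §2.2] -/
theorem isDeRhamWithWeightsIn_bdR_cyclotomicPadicAlgCl :
    letI := LocalField.padicAlgebra F p hp
    haveI : Fact (¬ IsUnit (p : integerC F)) := ⟨not_isUnit_natCast_integerC hp⟩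
    haveI := isAdicComplete_integerC_natCast (F := F) hp
    FramedRep.IsDeRhamWithWeightsIn (bdRPeriodRingData (F := F) (p := p) hp) (-1) (-1)
      (FramedGaloisRep.cyclotomicPadicAlgCl F p) := by
  letI := LocalField.padicAlgebra F p hp
  haveI : Fact (¬ IsUnit (p : integerC F)) := ⟨not_isUnit_natCast_integerC hp⟩
  haveI := isAdicComplete_integerC_natCast (F := F) hp
  exact isDeRhamWithWeightsIn_cyclotomicPadicAlgCl _ (isAdmissible_bdR_cyclotomicRepQp_padicAlgebra hp)
    (hodgeTateWeights_bdR_cyclotomicRepQp_padicAlgebra hp)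

end Literature.NumberTheory.PAdicHodge


end
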